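import Summits.QuantumFields.YangMills.Theorems.IR.Negative.TypShellCondFalseAllG.Frame

/-!
# Crux `IR` (stmt-QuantumFields-19354) — the fixed-mesh negative for format T and the onset floor FOR EVERY COMPACT
# GAUGE GROUP, part 6/8: §10b the comb's gauge tree on the torus, input T discharged (section `TreeGauge`);
# §11⁰ the ROW formats (section `RowFormats`, certideate-2's text verbatim)

Re-homed VERBATIM (statements, proofs, names; namespace `…Cruxes.IR.CruxIdea2g6` ↦ `…Cruxes.IR.FixedMeshAllG`) from the crux
workfile `Cruxes/IR/CruxIdea2FrameRowAllG.lean` rev 2 (sha16 81bea4c546c46a61; author `ym-cruxidea-19354-2` GEN 6) per owner R88,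
split into eight ≤ 400-line modules; credit docstring of record in `Theorems/IR/Negative/TypShellCondFalseAllG.lean` (part 8/8).
-/

set_option autoImplicit false

noncomputable section

open MeasureTheory Filter Topology
open Literature.MathematicalPhysics.QuantumLattice
open Literature.Probability.LatticeModels
open Summit.QuantumFields.YangMills.Cruxes.IR.Tempered (cellEdges windowCells regionEdges)
open Summit.QuantumFields.YangMills.Cruxes.IR.ShellTempered (windowCellsPlus)
open Summit.QuantumFields.YangMills.Cruxes.IR.OnsetFormats (TypShellCond shellCount)
open Summit.QuantumFields.YangMills.Cruxes.IR.FixedMesh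

namespace Summit.QuantumFields.YangMills.Cruxes.IR.FixedMeshAllG

/-! ## §10b The comb's gauge tree on the torus; INPUT T DISCHARGED for the comb twist (PROVED) -/

section TreeGauge

open Literature.MathematicalPhysics.QuantumFieldTheory (GaugeConfig gaugeTransform haarProbability Edge wilsonMeasure
  wilsonAction measurable_torusLift)

variable {G : Type} [Group G] [TopologicalSpace G] [IsTopologicalGroup G] [CompactSpace G]
  [SecondCountableTopology G] [MeasurableSpace G] [BorelSpace G]
  {N : ℕ} (ρ : G →* Matrix (Fin N) (Fin N) ℂ)

omit [TopologicalSpace G] [IsTopologicalGroup G] [CompactSpace G] [SecondCountableTopology G]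
  [MeasurableSpace G] [BorelSpace G] in
/-- Direction 2 from the comb spine (`x 3 = -R`): definitional extension, no flatness. -/
theorem stair_add_single_two_base (ζ : LGConfig 4 G) {b R : ℕ} {x : Site 4} (hx : InLayer b R x)
    (h3 : combLen R x 3 = 0) : stair b R ζ (x + Pi.single 2 1) = stair b R ζ x * ζ (x, 2) := by
  have hx3 := combPt3_add_eq hx
  have e1 : combLen R (x + Pi.single 2 1) 1 = combLen R x 1 := combLen_add_single_of_ne x (by decide)
  have e3 : combLen R (x + Pi.single 2 1) 3 = combLen R x 3 := combLen_add_single_of_ne x (by decide)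
  have e2 : combLen R (x + Pi.single 2 1) 2 = combLen R x 2 + 1 := combLen_add_single_self (hx.2 2 (by decide))
  have p2 : combPt2 b R (x + Pi.single 2 1) = combPt2 b R x := by simp only [combPt2, e1]
  have p3 : combPt3 b R (x + Pi.single 2 1) = combPt3 b R x + Pi.single 2 1 := by
    simp only [combPt3, p2, e2, single_natCast_succ, add_assoc]
  have hp3 : combPt2 b R x + Pi.single 2 (combLen R x 2 : ℤ) = combPt3 b R x := rfl
  rw [h3] at hx3
  have hx3' : combPt3 b R x = x := by simpa using hx3
  unfold stair
  rw [e1, e2, e3, p2, p3, zline_succ_right, hp3, h3, zline_zero, zline_zero, mul_one, mul_one, hx3']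
  simp only [mul_assoc]

omit [TopologicalSpace G] [IsTopologicalGroup G] [CompactSpace G] [SecondCountableTopology G]
  [MeasurableSpace G] [BorelSpace G] in
/-- Direction 1 from the comb root line (`x 2 = x 3 = -R`): definitional extension, no flatness. -/
theorem stair_add_single_one_base (ζ : LGConfig 4 G) {b R : ℕ} {x : Site 4} (hx : InLayer b R x)
    (h2 : combLen R x 2 = 0) (h3 : combLen R x 3 = 0) :
    stair b R ζ (x + Pi.single 1 1) = stair b R ζ x * ζ (x, 1) := by
  have hx3 := combPt3_add_eq hx
  have e2 : combLen R (x + Pi.single 1 1) 2 = combLen R x 2 := combLen_add_single_of_ne x (by decide)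
  have e3 : combLen R (x + Pi.single 1 1) 3 = combLen R x 3 := combLen_add_single_of_ne x (by decide)
  have e1 : combLen R (x + Pi.single 1 1) 1 = combLen R x 1 + 1 := combLen_add_single_self (hx.2 1 (by decide))
  have hp2 : combRoot b R + Pi.single 1 (combLen R x 1 : ℤ) = combPt2 b R x := rfl
  have hx2 : combPt2 b R x = x := by
    have : combPt3 b R x = combPt2 b R x := by simp [combPt3, h2]
    rw [h3] at hx3; simpa [this] using hx3
  unfold stair
  rw [e1, e2, e3, h2, h3, zline_zero, zline_zero, zline_zero, zline_zero, mul_one, mul_one, mul_one, mul_one,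
    zline_succ_right, hp2, hx2]

omit [TopologicalSpace G] [IsTopologicalGroup G] [CompactSpace G] [SecondCountableTopology G]
  [MeasurableSpace G] [BorelSpace G] in
/-- A line transport reads only its own links. -/
theorem zline_congr {ζ ζ' : LGConfig 4 G} (ν : Fin 4) : ∀ (n : ℕ) (y : Site 4),
    (∀ s : ℕ, s < n → ζ (y + Pi.single ν (s : ℤ), ν) = ζ' (y + Pi.single ν (s : ℤ), ν)) →
    zline ζ ν n y = zline ζ' ν n y
  | 0, _, _ => by simp
  | n + 1, y, h => by
    rw [zline_succ, zline_succ]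
    have h0 := h 0 (Nat.succ_pos n)
    simp only [Nat.cast_zero, Pi.single_zero, add_zero] at h0
    rw [h0, zline_congr ν n (y + Pi.single ν 1) fun s hs => ?_]
    have h1 := h (s + 1) (by omega)
    rwa [← single_add_nat, ← add_assoc] at h1

/-- The comb's GAUGE TREE on the torus of side `2R+1` (read through centred representatives): the layer links in
direction 3 (except the wrapping one), in direction 2 on the spine `x₃ = -R`, in direction 1 on the root line. -/
def IsTreeEdge (b R : ℕ) (e : Edge 4 (2 * R + 1)) : Prop :=
  Torus.cRep e.1 0 = (b : ℤ) + 1 ∧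
  ((e.2 = 3 ∧ Torus.cRep e.1 3 ≠ (R : ℤ)) ∨
   (e.2 = 2 ∧ Torus.cRep e.1 3 = -(R : ℤ) ∧ Torus.cRep e.1 2 ≠ (R : ℤ)) ∨
   (e.2 = 1 ∧ Torus.cRep e.1 3 = -(R : ℤ) ∧ Torus.cRep e.1 2 = -(R : ℤ) ∧ Torus.cRep e.1 1 ≠ (R : ℤ)))

/-- The torus gauge function of the comb twist: the layer gauge of the comb, read at centred representatives. -/
def treeGauge (b R : ℕ) (k₀ : G) (V : GaugeConfig 4 (2 * R + 1) G)
    (u : Literature.MathematicalPhysics.QuantumFieldTheory.Site 4 (2 * R + 1)) : G :=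
  layerGauge b (comb b R k₀ (torusLift (2 * R + 1) V)) (Torus.cRep u)

omit [TopologicalSpace G] [IsTopologicalGroup G] [CompactSpace G] [SecondCountableTopology G]
  [MeasurableSpace G] [BorelSpace G] in
/-- Workfile theorem `cRep_bounds` (cruxidea-2 g6, `CruxIdea2FrameRowAllG.lean` rev 2, re-homed verbatim;
see the module docstring). -/
theorem cRep_bounds {R : ℕ} (u : Literature.MathematicalPhysics.QuantumFieldTheory.Site 4 (2 * R + 1)) (i : Fin 4) :
    -(R : ℤ) ≤ Torus.cRep u i ∧ Torus.cRep u i ≤ R := by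
  have h := Torus.two_mul_cRepZ_bounds (L := 2 * R + 1) (u i)
  show -(R : ℤ) ≤ Torus.cRepZ (u i) ∧ Torus.cRepZ (u i) ≤ R
  push_cast at h
  omega

omit [TopologicalSpace G] [IsTopologicalGroup G] [CompactSpace G] [SecondCountableTopology G]
  [MeasurableSpace G] [BorelSpace G] in
/-- Workfile theorem `proj_add_single` (cruxidea-2 g6, `CruxIdea2FrameRowAllG.lean` rev 2, re-homed verbatim;
see the module docstring). -/
theorem proj_add_single (L : ℕ) (x : Site 4) (j : Fin 4) :
    Torus.proj L (x + Pi.single j 1) =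
      Literature.MathematicalPhysics.QuantumFieldTheory.Site.shift (Torus.proj L x) j := by
  funext i
  simp only [Literature.MathematicalPhysics.QuantumFieldTheory.Site.shift, Torus.proj_apply, Pi.add_apply,
    Pi.single_apply, Int.cast_add]
  split_ifs <;> simp

omit [TopologicalSpace G] [IsTopologicalGroup G] [CompactSpace G] [SecondCountableTopology G]
  [MeasurableSpace G] [BorelSpace G] in
/-- A `ℤ⁴` edge in the centred box whose coordinates satisfy the tree conditions projects to a tree edge. -/
theorem isTreeEdge_proj {b R : ℕ} {z : Site 4} (hz : ∀ i, -(R : ℤ) ≤ z i ∧ z i ≤ R) {ν : Fin 4}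
    (h : z 0 = (b : ℤ) + 1 ∧ ((ν = 3 ∧ z 3 ≠ (R : ℤ)) ∨ (ν = 2 ∧ z 3 = -(R : ℤ) ∧ z 2 ≠ (R : ℤ)) ∨
      (ν = 1 ∧ z 3 = -(R : ℤ) ∧ z 2 = -(R : ℤ) ∧ z 1 ≠ (R : ℤ)))) :
    IsTreeEdge b R (Torus.proj (2 * R + 1) z, ν) := by
  unfold IsTreeEdge
  rw [Torus.cRep_proj_of_mem_box (M := R) (by omega) (mem_box.2 hz)]
  exact h

omit [TopologicalSpace G] [IsTopologicalGroup G] [CompactSpace G] [SecondCountableTopology G]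
  [MeasurableSpace G] [BorelSpace G] in
/-- **The tree gauge reads only tree links (PROVED).** -/
theorem treeGauge_dep {b R : ℕ} (hbR : b + 1 ≤ R) (k₀ : G) (V W : GaugeConfig 4 (2 * R + 1) G)
    (hVW : ∀ e, IsTreeEdge b R e → V e = W e) : treeGauge b R k₀ V = treeGauge b R k₀ W := by
  funext u
  unfold treeGauge layerGauge
  split_ifs with hx0
  · set x := Torus.cRep u with hxdef
    have hxb : ∀ i, -(R : ℤ) ≤ x i ∧ x i ≤ R := fun i => cRep_bounds u i
    have hb1 := hxb 1; have hb2 := hxb 2; have hb3 := hxb 3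
    have hlift : ∀ (U : GaugeConfig 4 (2 * R + 1) G) (z : Site 4) (ν : Fin 4),
        torusLift (2 * R + 1) U (z, ν) = U (Torus.proj (2 * R + 1) z, ν) := fun U z ν => rfl
    have hbR' : (b : ℤ) + 1 ≤ R := by exact_mod_cast hbR
    have f1 : zline (torusLift (2 * R + 1) V) 1 (combLen R x 1) (combRoot b R) =
        zline (torusLift (2 * R + 1) W) 1 (combLen R x 1) (combRoot b R) := by
      refine zline_congr 1 _ _ fun s hs => ?_
      have hs' : (s : ℤ) < x 1 + R := by
        have : (combLen R x 1 : ℤ) = x 1 + R := by simp only [combLen]; have := hxb 1; omega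
        omega
      rw [hlift, hlift]
      refine hVW _ (isTreeEdge_proj (fun i => ?_) ⟨?_, Or.inr (Or.inr ⟨rfl, ?_, ?_, ?_⟩)⟩)
      all_goals simp only [combRoot, Pi.add_apply, Pi.single_apply]
      · have := hxb 1; fin_cases i <;> simp <;> omega
      all_goals simp; try omega
    have f2 : zline (torusLift (2 * R + 1) V) 2 (combLen R x 2) (combPt2 b R x) =
        zline (torusLift (2 * R + 1) W) 2 (combLen R x 2) (combPt2 b R x) := by
      refine zline_congr 2 _ _ fun s hs => ?_
      have hl1 : (combLen R x 1 : ℤ) = x 1 + R := by simp only [combLen]; have := hxb 1; omega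
      have hs' : (s : ℤ) < x 2 + R := by
        have : (combLen R x 2 : ℤ) = x 2 + R := by simp only [combLen]; have := hxb 2; omega
        omega
      rw [hlift, hlift]
      refine hVW _ (isTreeEdge_proj (fun i => ?_) ⟨?_, Or.inr (Or.inl ⟨rfl, ?_, ?_⟩)⟩)
      all_goals simp only [combPt2, combRoot, Pi.add_apply, Pi.single_apply]
      · have := hxb 1; have := hxb 2; fin_cases i <;> simp <;> omega
      all_goals simp; try omega
    have f3 : zline (torusLift (2 * R + 1) V) 3 (combLen R x 3) (combPt3 b R x) =
        zline (torusLift (2 * R + 1) W) 3 (combLen R x 3) (combPt3 b R x) := by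
      refine zline_congr 3 _ _ fun s hs => ?_
      have hl1 : (combLen R x 1 : ℤ) = x 1 + R := by simp only [combLen]; have := hxb 1; omega
      have hl2 : (combLen R x 2 : ℤ) = x 2 + R := by simp only [combLen]; have := hxb 2; omega
      have hs' : (s : ℤ) < x 3 + R := by
        have : (combLen R x 3 : ℤ) = x 3 + R := by simp only [combLen]; have := hxb 3; omega
        omega
      rw [hlift, hlift]
      refine hVW _ (isTreeEdge_proj (fun i => ?_) ⟨?_, Or.inl ⟨rfl, ?_⟩⟩)
      all_goals simp only [combPt3, combPt2, combRoot, Pi.add_apply, Pi.single_apply]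
      · have := hxb 1; have := hxb 2; have := hxb 3; fin_cases i <;> simp <;> omega
      all_goals simp; try omega
    unfold comb stair
    rw [f1, f2, f3]
  · rfl

omit [TopologicalSpace G] [IsTopologicalGroup G] [CompactSpace G] [SecondCountableTopology G]
  [MeasurableSpace G] [BorelSpace G] in
/-- **The comb twist fixes its tree links (PROVED; definitional covariance along the comb).** -/
theorem treeGauge_fix {b R : ℕ} (hbR : b + 1 ≤ R) (k₀ : G) (V : GaugeConfig 4 (2 * R + 1) G)
    (e : Edge 4 (2 * R + 1)) (he : IsTreeEdge b R e) : gaugeTransform (treeGauge b R k₀ V) V e = V e := by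
  obtain ⟨u, j⟩ := e
  set x := Torus.cRep u with hxdef
  have hxb : ∀ i, -(R : ℤ) ≤ x i ∧ x i ≤ R := fun i => cRep_bounds u i
  obtain ⟨hx0, hbr⟩ := he
  simp only at hx0 hbr
  rw [← hxdef] at hx0 hbr
  have hbR' : (b : ℤ) + 1 ≤ R := by exact_mod_cast hbR
  have hjR : x j < R := by
    rcases hbr with ⟨rfl, h⟩ | ⟨rfl, _, h⟩ | ⟨rfl, _, _, h⟩ <;> exact lt_of_le_of_ne (hxb _).2 h
  have hj0 : j ≠ 0 := by
    rcases hbr with ⟨rfl, _⟩ | ⟨rfl, _⟩ | ⟨rfl, _⟩ <;> decide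
  have hmem : x + Pi.single j 1 ∈ box 4 R := by
    rw [mem_box]; intro i
    rw [Pi.add_apply, Pi.single_apply]
    have := hxb i
    split_ifs with h
    · subst h; constructor <;> omega
    · simpa using this
  have hshift : Torus.cRep (Literature.MathematicalPhysics.QuantumFieldTheory.Site.shift u j) = x + Pi.single j 1 := by
    have hu : Literature.MathematicalPhysics.QuantumFieldTheory.Site.shift u j = Torus.proj (2 * R + 1) (x + Pi.single j 1) := by
      rw [proj_add_single, hxdef, Torus.proj_cRep]
    rw [hu, Torus.cRep_proj_of_mem_box (M := R) (by omega) hmem]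
  have hxL : InLayer b R x := ⟨hx0, fun l _ => (hxb l).1⟩
  have hst : stair b R (torusLift (2 * R + 1) V) (x + Pi.single j 1) =
      stair b R (torusLift (2 * R + 1) V) x * torusLift (2 * R + 1) V (x, j) := by
    rcases hbr with ⟨rfl, _⟩ | ⟨rfl, h3, _⟩ | ⟨rfl, h3, h2, _⟩
    · exact stair_add_single_three _ hxL
    · exact stair_add_single_two_base _ hxL (by simp [combLen, h3])
    · exact stair_add_single_one_base _ hxL (by simp [combLen, h2]) (by simp [combLen, h3])
  have hlink : torusLift (2 * R + 1) V (x, j) = V (u, j) := by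
    show V (Torus.proj _ x, j) = V (u, j)
    rw [hxdef, Torus.proj_cRep]
  have h0' : (x + Pi.single j (1 : ℤ) : Site 4) 0 = (b : ℤ) + 1 := by
    rw [Pi.add_apply, Pi.single_eq_of_ne (Ne.symm hj0), add_zero, hx0]
  show treeGauge b R k₀ V u * V (u, j) *
      (treeGauge b R k₀ V (Literature.MathematicalPhysics.QuantumFieldTheory.Site.shift u j))⁻¹ = V (u, j)
  have h1 : treeGauge b R k₀ V u = comb b R k₀ (torusLift (2 * R + 1) V) x := by
    simp only [treeGauge, layerGauge, ← hxdef, if_pos hx0]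
  have h2 : treeGauge b R k₀ V (Literature.MathematicalPhysics.QuantumFieldTheory.Site.shift u j) =
      comb b R k₀ (torusLift (2 * R + 1) V) (x + Pi.single j 1) := by
    simp only [treeGauge, layerGauge, hshift, if_pos h0']
  rw [h1, h2, comb, comb, hst, hlink]
  group

omit [CompactSpace G] in
/-- The tree gauge is measurable in the configuration (indeed continuous). -/
theorem measurable_treeGauge (b R : ℕ) (k₀ : G) (u : Literature.MathematicalPhysics.QuantumFieldTheory.Site 4 (2 * R + 1)) :
    Measurable fun V : GaugeConfig 4 (2 * R + 1) G => treeGauge b R k₀ V u := by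
  unfold treeGauge layerGauge
  split_ifs
  · exact ((continuous_comb b R k₀ _).comp (continuous_torusLift _)).measurable
  · exact measurable_const

/-- **INPUT T DISCHARGED for the comb twist (PROVED).**  The comb-twisted periodic datum is, on every window+shell
cell, either the datum itself (cells off the row layer) or the periodic lift of the tree-dependent gauge transform
`V ↦ V^{h(V)}` (row-layer cells, whose edges sit in the centred box), and the latter preserves the Wilson measure by the
skew-product lemma; so cell-atypicality probabilities are transported exactly. -/
theorem topTwistTransfer_comb {b : ℕ} (hb : 1 ≤ b) (n : ℕ) (k₀ : G) :
    TopTwistTransfer ρ (comb b ((2 * n + 2) * b + 1) k₀) b n := by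
  classical
  intro β Typ hmeasT hdepT c hc
  set R : ℕ := (2 * n + 2) * b + 1 with hR
  have hbR : b + 1 ≤ R := by rw [hR]; nlinarith
  have hmap := wilsonMeasure_map_gaugeTransform_dep ρ β (IsTreeEdge b R) (treeGauge b R k₀)
    (treeGauge_dep hbR k₀) (treeGauge_fix hbR k₀) (measurable_treeGauge b R k₀)
  have hΨm : Measurable fun V : GaugeConfig 4 (2 * R + 1) G => gaugeTransform (treeGauge b R k₀ V) V :=
    measurable_pi_iff.2 fun i => (((measurable_treeGauge b R k₀ _).mul (measurable_pi_apply i)).mul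
      (measurable_treeGauge b R k₀ _).inv)
  have hAm : MeasurableSet {V : GaugeConfig 4 (2 * R + 1) G | torusLift (2 * R + 1) V ∉ Typ c} :=
    (hmeasT c).compl.preimage (measurable_torusLift _)
  by_cases hc0 : c 0 = 0
  · have hkey : {V : GaugeConfig 4 (2 * R + 1) G | twistΦ b (comb b R k₀) (torusLift (2 * R + 1) V) ∉ Typ c} =
        (fun V => gaugeTransform (treeGauge b R k₀ V) V) ⁻¹'
          {V : GaugeConfig 4 (2 * R + 1) G | torusLift (2 * R + 1) V ∉ Typ c} := by
      ext V
      simp only [Set.mem_setOf_eq, Set.mem_preimage, not_iff_not]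
      have hagree : ∀ e ∈ (↑(cellEdges (stdFrame b) c) : Set (ZdEdge 4)),
          twistΦ b (comb b R k₀) (torusLift (2 * R + 1) V) e =
            torusLift (2 * R + 1) (gaugeTransform (treeGauge b R k₀ V) V) e := by
        intro e he
        have hbox := cellEdges_endpoints_mem_box (S := R) le_rfl hc (Finset.mem_coe.1 he)
        rw [twistΦ, topTwist_eq_gauge_on_rowLayer _ _ hc0 e (Finset.mem_coe.1 he),
          WilsonBlockHeatBath.torusLift_gaugeTransform]
        simp only [gaugeTransformZd, Function.comp_apply, treeGauge]
        rw [Torus.cRep_proj_of_mem_box (M := R) (by omega) hbox.1, Torus.cRep_proj_of_mem_box (M := R) (by omega) hbox.2]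
      exact Iff.of_eq (hdepT c hagree)
    rw [hkey, ← Measure.map_apply hΨm hAm, hmap]
  · have hkey : {V : GaugeConfig 4 (2 * R + 1) G | twistΦ b (comb b R k₀) (torusLift (2 * R + 1) V) ∉ Typ c} =
        {V : GaugeConfig 4 (2 * R + 1) G | torusLift (2 * R + 1) V ∉ Typ c} := by
      ext V
      simp only [Set.mem_setOf_eq, not_iff_not]
      exact Iff.of_eq (hdepT c fun e he => topTwist_eq_self_off_rowLayer hb _ _ hc0 e (Finset.mem_coe.1 he))
    rw [hkey]

end TreeGauge


section RowFormats

/-! ## §11⁰ (rev 2) The ROW formats — certideate-2's text, copied VERBATIM from `ym-19354-certideate-2/Sketch-g14.lean`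
§C (b355902ce34dc08b; defs `RowClauseI`, `RowShellCondUKP`, `RowShellCond`, `RowOnsetDivergesAll`, `RowOnsetDivergesAny`,
`RowOnsetDivergesAnyU` and the definitional lemmas), so that the theorems of §11c below are statements about THEIR
named Props (bridge = `Iff.rfl` once both files sit in one namespace). -/

open Literature.MathematicalPhysics.QuantumFieldTheory (wilsonMeasure GaugeConfig)

variable {G : Type} [Group G] [TopologicalSpace G] [IsTopologicalGroup G] [CompactSpace G]
  [MeasurableSpace G] [BorelSpace G]

/-- **Clause (i) AT THE ROW ONLY** (g8 text verbatim): sub-region mixing among typical, agreeing data asked at the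
single shape `Y = rowCells n` — cell `0`'s time layer across the window, the one-cell slab sandwiched between equal
typical plates, rim typical-but-free at transverse cell-distance `n`. -/
def RowClauseI {N : ℕ} (ρ : G →* Matrix (Fin N) (Fin N) ℂ) (β : ℝ) (w : Fin 4 → ℤ → ℤ) (n : ℕ) (ε : ℝ)
    (Typ : (Fin 4 → ℤ) → Set (LGConfig 4 G)) : Prop :=
  ∀ σ σ' : LGConfig 4 G,
    (∀ c ∈ windowCellsPlus n, c ∉ rowCells n → σ ∈ Typ c ∧ σ' ∈ Typ c) →
    (∀ c ∈ windowCellsPlus n, c ∉ rowCells n → c ∈ windowCells n → ∀ e ∈ cellEdges w c, σ e = σ' e) →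
    ∀ f : LGConfig 4 G → ℝ, IsCylinder f (cellEdges w 0) → Measurable f → (∀ U, 0 ≤ f U ∧ f U ≤ 1) →
      |(∫ U, f U ∂(ymSpecification ρ β (regionEdges w (rowCells n)) σ)) -
        ∫ U, f U ∂(ymSpecification ρ β (regionEdges w (rowCells n)) σ')| ≤ ε

/-- **PROVED (definitional).** The tree's clause (i_T) (`FixedMesh.ClauseI`, all admissible shapes `Y ∋ 0`) implies
the row clause (its instance `Y = rowCells n`). -/
theorem rowClauseI_of_clauseI {N : ℕ} {ρ : G →* Matrix (Fin N) (Fin N) ℂ} {β : ℝ} {w : Fin 4 → ℤ → ℤ} {n : ℕ}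
    {ε : ℝ} {Typ : (Fin 4 → ℤ) → Set (LGConfig 4 G)} (h : FixedMesh.ClauseI ρ β w n ε Typ) :
    RowClauseI ρ β w n ε Typ :=
  fun σ σ' hTyp hagree => h (rowCells n) (rowCells_subset n) (zero_mem_rowCells n) σ σ' hTyp hagree

/-- **The ROW FORMAT IN U CLOTHES** `RowShellCondUKP ρ β b n ε δ`: format U (`TypShellCondUKP`, slot text) with its
clause (i) replaced by `RowClauseI` (the instance `Y = rowCells n`); clauses (ii_U) (UKP joint kernel rarity) and (iii)
(torus anchor) VERBATIM — they make `Typ` co-rare, hence the row clause non-vacuous. -/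
def RowShellCondUKP {N : ℕ} (ρ : G →* Matrix (Fin N) (Fin N) ℂ) (β : ℝ) (b n : ℕ) (ε δ : ℝ) : Prop :=
  ∀ w : Fin 4 → ℤ → ℤ, (∀ i j, w i j + ((b : ℕ) : ℤ) ≤ w i (j + 1) ∧ w i (j + 1) ≤ w i j + 2 * ((b : ℕ) : ℤ)) →
    ∃ Typ : (Fin 4 → ℤ) → Set (LGConfig 4 G),
      (∀ c, MeasurableSet (Typ c)) ∧ (∀ c, DependsOn (fun σ : LGConfig 4 G => σ ∈ Typ c) ↑(cellEdges w c)) ∧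
      RowClauseI ρ β w n ε Typ ∧
      (∀ F F' : Finset (Fin 4 → ℤ), F ⊆ F' → F.Nonempty → ∀ ζ : LGConfig 4 G,
        (∀ c ∈ F, ∀ c' : Fin 4 → ℤ, (∀ i, |c' i - c i| ≤ 1) → c' ∈ F' ∨ ζ ∈ Typ c') →
          (ymSpecification ρ β (regionEdges w F') ζ) {σ : LGConfig 4 G | ∀ c ∈ F, σ ∉ Typ c} ≤
            ENNReal.ofReal (δ ^ F.card)) ∧
      (∀ S : ℕ, 4 * b ≤ 2 * S + 1 → ∀ F : Finset (Fin 4 → ℤ), F.Nonempty →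
        (∀ c ∈ F, ∀ i, -(S : ℤ) ≤ w i (c i) ∧ w i (c i + 1) ≤ (S : ℤ) + 1) →
          (wilsonMeasure (d := 4) (L := 2 * S + 1) ρ β)
              {V : GaugeConfig 4 (2 * S + 1) G | ∀ c ∈ F, torusLift (2 * S + 1) V ∉ Typ c} ≤
            ENNReal.ofReal (δ ^ F.card))

/-- **The g8 ROW FORMAT (format-T clothes)** `RowShellCond` — g8 `Sketch-g8.lean` :175 verbatim: clause (i) at the row,
(ii_T) (collar-typical joint kernel rarity) and (iii) verbatim from the registry text of format T.  Kept because the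
S-port stub of §E is naturally a statement about THIS (weaker) format. -/
def RowShellCond {N : ℕ} (ρ : G →* Matrix (Fin N) (Fin N) ℂ) (β : ℝ) (b n : ℕ) (ε δ : ℝ) : Prop :=
  ∀ w : Fin 4 → ℤ → ℤ, (∀ i j, w i j + ((b : ℕ) : ℤ) ≤ w i (j + 1) ∧ w i (j + 1) ≤ w i j + 2 * ((b : ℕ) : ℤ)) →
    ∃ Typ : (Fin 4 → ℤ) → Set (LGConfig 4 G),
      (∀ c, MeasurableSet (Typ c)) ∧ (∀ c, DependsOn (fun σ : LGConfig 4 G => σ ∈ Typ c) ↑(cellEdges w c)) ∧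
      RowClauseI ρ β w n ε Typ ∧
      (∀ F F' : Finset (Fin 4 → ℤ), F ⊆ F' → F.Nonempty → ∀ ζ : LGConfig 4 G,
        (∀ c' : Fin 4 → ℤ, c' ∉ F' → (∃ c ∈ F', ∀ i, |c' i - c i| ≤ 1) → ζ ∈ Typ c') →
          (ymSpecification ρ β (regionEdges w F') ζ) {σ : LGConfig 4 G | ∀ c ∈ F, σ ∉ Typ c} ≤
            ENNReal.ofReal (δ ^ F.card)) ∧
      (∀ S : ℕ, 4 * b ≤ 2 * S + 1 → ∀ F : Finset (Fin 4 → ℤ), F.Nonempty →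
        (∀ c ∈ F, ∀ i, -(S : ℤ) ≤ w i (c i) ∧ w i (c i + 1) ≤ (S : ℤ) + 1) →
          (wilsonMeasure (d := 4) (L := 2 * S + 1) ρ β)
              {V : GaugeConfig 4 (2 * S + 1) G | ∀ c ∈ F, torusLift (2 * S + 1) V ∉ Typ c} ≤
            ENNReal.ofReal (δ ^ F.card))

/-- **S-ROS-6 (ctriage-2's class) `RowOnsetDivergesAll ρ`** (certideate-2 text verbatim). -/
def RowOnsetDivergesAll {N : ℕ} (ρ : G →* Matrix (Fin N) (Fin N) ℂ) : Prop :=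
  ConnectedSpace G → (∃ a b : G, a * b ≠ b * a) →
    Continuous ρ → Function.Injective ρ → (∀ g, ρ g ∈ Matrix.unitaryGroup (Fin N) ℂ) → 1 ≤ N →
      ∀ {b : ℕ}, 1 ≤ b → ∀ (n : ℕ) {ε δ : ℝ}, 0 ≤ ε → ε < 1 / 2 → 0 ≤ δ →
        4 * ((windowCellsPlus n).card : ℝ) * δ < 1 →
          ∃ β₀ : ℝ, ∀ β : ℝ, β₀ ≤ β → ¬ RowShellCond ρ β b n ε δ

/-- **S-ROS-6, widest class: `RowOnsetDivergesAny ρ`** (certideate-2 text verbatim) — the same conclusion for every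
compact NON-TRIVIAL `G`. -/
def RowOnsetDivergesAny {N : ℕ} (ρ : G →* Matrix (Fin N) (Fin N) ℂ) : Prop :=
  Nontrivial G →
    Continuous ρ → Function.Injective ρ → (∀ g, ρ g ∈ Matrix.unitaryGroup (Fin N) ℂ) → 1 ≤ N →
      ∀ {b : ℕ}, 1 ≤ b → ∀ (n : ℕ) {ε δ : ℝ}, 0 ≤ ε → ε < 1 / 2 → 0 ≤ δ →
        4 * ((windowCellsPlus n).card : ℝ) * δ < 1 →
          ∃ β₀ : ℝ, ∀ β : ℝ, β₀ ≤ β → ¬ RowShellCond ρ β b n ε δ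

/-- **PROVED** (certideate-2 text verbatim).  The widest-class floor implies ctriage-2's S-ROS-6. -/
theorem rowOnsetDivergesAll_of_any {N : ℕ} {ρ : G →* Matrix (Fin N) (Fin N) ℂ} (h : RowOnsetDivergesAny ρ) :
    RowOnsetDivergesAll ρ := by
  intro _ hab hc hi hu hN b hb n ε δ hε hε2 hδ hδ'
  obtain ⟨a, b', hab'⟩ := hab
  have hnt : Nontrivial G := by
    refine ⟨⟨a, 1, fun ha => hab' ?_⟩⟩
    rw [ha, one_mul, mul_one]
  exact h hnt hc hi hu hN hb n hε hε2 hδ hδ'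

/-- The widest-class floor for the U-row format (certideate-2 text verbatim). -/
def RowOnsetDivergesAnyU {N : ℕ} (ρ : G →* Matrix (Fin N) (Fin N) ℂ) : Prop :=
  Nontrivial G →
    Continuous ρ → Function.Injective ρ → (∀ g, ρ g ∈ Matrix.unitaryGroup (Fin N) ℂ) → 1 ≤ N →
      ∀ {b : ℕ}, 1 ≤ b → ∀ (n : ℕ) {ε δ : ℝ}, 0 ≤ ε → ε < 1 / 2 → 0 ≤ δ →
        4 * ((windowCellsPlus n).card : ℝ) * δ < 1 →
          ∃ β₀ : ℝ, ∀ β : ℝ, β₀ ≤ β → ¬ RowShellCondUKP ρ β b n ε δ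

end RowFormats

end Summit.QuantumFields.YangMills.Cruxes.IR.FixedMeshAllG

end
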